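import Literature.NumberTheory.EllipticCurves.Rank1Residual.Typed.HigherDescentCertificate
import Literature.NumberTheory.EllipticCurves.BSDShaProofs
import Literature.GroupTheory.FiniteAbelian.AlternatingPairing
import HarnessLib

/-!
# Class X5 (`p = 2`): the STABILISATION line `Ш[8] = Ш[4]` of the X5-core descent datum from PAIRING DATA —
# engine G (Cassels–Tate bits) structure-free, and engine-H mode A (ONE witness) from the Cassels–Tate named fact
# (cell `b2b-bsdres`, unit `b2b-bsdres-sha-1`, gen 5; companion of `Typed/X5DescentRoute.lean`)

HONEST FRAMING (run/shared/lean/b2b/bsd-rank1-residual/, verbatim): prove what is provable now;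
shrink each hard class to its core with data; no claim beyond stated classes. X5 stays
CONSTRUCTION-SHAPED; nothing here is a named fact (the Cassels–Tate pairing enters as the tree's
EXISTING named fact `WeierstrassCurve.exists_casselsTate_pairing`, bsd.S18, as a HYPOTHESIS);
nothing is booked; no `sorry`.

WHAT THIS FILE SETTLES. `Typed/X5DescentRoute.lean` typed the structure input of engine G and of
engine-H mode A as an explicit DICHOTOMY hypothesis. Here that hypothesis is REMOVED:

* **Engine G (`m = 1`) is structure-free.** Engine G values the Cassels–Tate pairing
  `⟨x₄, y⟩ ∈ ½ℤ/ℤ` for `x₄ ∈ Sel^(4)(E)` a `4`-covering above each Ш-type `ξ ∈ Sel^(2)(E)` and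
  `y ∈ Sel^(2)(E)`; its verdict `m = 1` says: for every non-zero `ξ ∈ Ш[2]` there is an `η` with
  `2η = ξ` and a `y ∈ Ш[2]` with `⟨η, y⟩ ≠ 0`. From BI-ADDITIVITY ALONE (any bi-additive
  `B : Ш × Ш → Q`) plus the `4`-descent line `Ш[2] ⊆ 2·Ш` (engine F / PARI: all three Ш-type
  `2`-coverings lift): a `2`-divisible `η = 2w` pairs trivially with `Ш[2]`
  (`B (2w) y = B w (2y) = 0`), and the bit is constant on `η + Ш[2]`; hence NO element of exact
  order `4` is `2`-divisible, i.e. `Ш[8] = Ш[4]` — `stable_four_of_pairing_bits`. No alternation,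
  no non-degeneracy, no finiteness, no structure theorem.
* **Engine-H mode A (one witness) needs exactly the named fact.** Mode A certifies ONE element
  `η₀ ∈ Ш[4]` of exact order `4` that is NOT twice an element of `Ш` (every `4`-covering above
  every `2`-covering of one full `Ш[2]`-class has EMPTY fake `2`-Selmer set, Stamminger Thm. 6.2.2).
  With the Cassels–Tate pairing `B` (alternating; kernel = divisible elements = `0` for finite `Ш`,
  GZK) the tree's `Literature.GroupTheory.FiniteAbelian.mem_range_nsmul_of_forall_torsionBy`
  ("the orthogonal of `Ш[2]` is `2Ш`") turns `η₀ ∉ 2Ш` into a `y₀ ∈ Ш[2]` with `B η₀ y₀ ≠ 0`;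
  since `Ш[2]` has FOUR elements (`s = 2`, three engines) the induced alternating form on
  `Ш[2] ≅ 𝔽₂²` is then THE symplectic form, so EVERY `η` of exact order `4` pairs non-trivially
  with some `y ∈ Ш[2]` (`pairing_bits_of_witness`, a four-element case analysis), and the first
  bullet applies: `stable_four_of_pairing_witness`. For `Ш(E/ℚ)`:
  `sha_orthogonal_two_of_casselsTate` packages the named fact + finiteness, and
  `X5.bsdp_two_of_pairing_bits` / `X5.bsdp_two_of_casselsTate_witness` feed the tree consumer
  `X5.bsdp_two_of_sha_eight_eq_sha_four` (p193410): `BSD(E,2)` granted GZK (and, for mode A,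
  granted bsd.S18).

So the per-curve data that discharge `X5.MissingInputAt W 2` on the X5 core are, precisely:
`#Ш[2] = 4` and `Ш[2] ⊆ 2Ш` (engines A = B = F; PARI CT + F), `#Ш[4] = 16` (idem),
`ord₂ #Ш_an = 4` (lane), and EITHER engine G's bits (any bi-additive pairing exhibiting them) OR
engine H mode S (`Typed/X5DescentRoute.lean`) OR engine H mode A's single witness + bsd.S18.

References: Silverman *AEC* X.4.14 [SilvermanAEC2009] (= bsd.S18, tree `exists_casselsTate_pairing`
[Cassels1962ArithmeticIV]); Cassels 1998 §1 [Cassels1998]; Swinnerton-Dyer 2013 §1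
[SwinnertonDyer2013]; Stamminger 2005 Thm. 6.2.2 (p. 73) [Stamminger2005]; Merriman–Siksek–Smart
1996 §4 [MerrimanSiksekSmart1996]; Miller 2011 Def. 1.1 [Miller2011LMS]; tree
`Literature/GroupTheory/FiniteAbelian/AlternatingPairing.lean`, `BSDShaProofs.lean`
(`divisibleElements_eq_bot_of_finite`).
-/

noncomputable section

open scoped Classical
open scoped AddSubgroup

open WeierstrassCurve Literature.NumberTheory.EllipticCurves
  Literature.NumberTheory.EllipticCurves.Rank1Residual
  Literature.GroupTheory.FiniteAbelian

namespace Literature.NumberTheory.EllipticCurves.Rank1Residual.Typed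

/-! ### §1 Algebra: pairing bits and the stabilisation `A[8] = A[4]` -/

section Algebra

variable {A : Type*} [AddCommGroup A] {Q : Type*} [AddCommGroup Q] (B : A →+ A →+ Q)

/-- **Engine G's verdict `m = 1` IS `A[8] = A[4]`, structure-free.** For ANY bi-additive pairing
`B : A × A → Q`: if `A[2] ⊆ 2A` (`hdiv`, the `4`-descent line) and for every non-zero `ξ ∈ A[2]`
some `η` with `2η = ξ` pairs non-trivially with some `y ∈ A[2]` (`hbits`, engine G), then
`8x = 0 ⇒ 4x = 0`: otherwise `ξ = 4x ≠ 0`, `η − 2x ∈ A[2] ⊆ 2A`, so `η = 2(x + w)` and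
`B η y = B (x + w) (2y) = 0`. [cite: SwinnertonDyer2013, §1 (shape of the Sel^(4) × Sel^(2) pairing test)]
[cite: SilvermanAEC2009, Thm. X.4.14 (bilinearity only)] -/
theorem stable_four_of_pairing_bits (hdiv : ∀ z : A, 2 • z = 0 → ∃ w : A, 2 • w = z)
    (hbits : ∀ ξ : A, 2 • ξ = 0 → ξ ≠ 0 → ∃ η y : A, 2 • η = ξ ∧ 2 • y = 0 ∧ B η y ≠ 0) :
    ∀ x : A, 8 • x = 0 → 4 • x = 0 := by
  intro x hx
  by_contra h4
  have e8 : (2 * 4) • x = 8 • x := by norm_num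
  have e4 : (2 * 2) • x = 4 • x := by norm_num
  have h2ξ : 2 • (4 • x) = 0 := by rw [smul_smul, e8, hx]
  obtain ⟨η, y, hη, hy, hB⟩ := hbits (4 • x) h2ξ h4
  -- `η - 2x ∈ A[2] ⊆ 2A`
  have hz : 2 • (η - 2 • x) = 0 := by rw [smul_sub, hη, smul_smul, e4, sub_self]
  obtain ⟨w, hw⟩ := hdiv _ hz
  have hη' : η = 2 • (x + w) := by rw [smul_add, hw]; abel
  apply hB
  rw [hη', map_nsmul, AddMonoidHom.nsmul_apply, ← map_nsmul, hy, map_zero]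

/-- In a `2`-torsion group with exactly four elements, two distinct non-zero elements `a, b` and
`a + b` exhaust the non-zero elements. Private helper (finite case analysis). [folklore] -/
private theorem torsionBy_two_cases (hcard : Nat.card (A[(2 : ℕ)]) = 4) {a b : A} (ha : 2 • a = 0)
    (hb : 2 • b = 0) (ha0 : a ≠ 0) (hb0 : b ≠ 0) (hab : a ≠ b) :
    ∀ v : A, 2 • v = 0 → v = 0 ∨ v = a ∨ v = b ∨ v = a + b := by
  intro v hv
  haveI : Finite (A[(2 : ℕ)]) := Nat.finite_of_card_ne_zero (by rw [hcard]; norm_num)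
  haveI : Fintype (A[(2 : ℕ)]) := Fintype.ofFinite _
  have hmem : ∀ {x : A}, 2 • x = 0 → x ∈ A[(2 : ℕ)] := fun hx => AddSubgroup.torsionBy.nsmul_iff.2 hx
  let a' : A[(2 : ℕ)] := ⟨a, hmem ha⟩
  let b' : A[(2 : ℕ)] := ⟨b, hmem hb⟩
  let v' : A[(2 : ℕ)] := ⟨v, hmem hv⟩
  have hab' : a' + b' = ⟨a + b, hmem (by rw [smul_add, ha, hb, add_zero])⟩ := rfl
  -- `a + b` is a fourth element
  have hnegb : -b = b := by
    rw [neg_eq_iff_add_eq_zero, ← two_nsmul]; exact hb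
  have h1 : a + b ≠ 0 := by
    intro h; apply hab; rw [add_eq_zero_iff_eq_neg.1 h, hnegb]
  have h2 : a + b ≠ a := by
    intro h; exact hb0 (by simpa using h)
  have h3 : a + b ≠ b := by
    intro h; exact ha0 (by simpa using h)
  -- the four-element finset is all of `A[2]`
  let S : Finset (A[(2 : ℕ)]) := {0, a', b', a' + b'}
  have hS : S.card = 4 := by
    have e0a : (0 : A[(2 : ℕ)]) ≠ a' := fun h => ha0 (congrArg Subtype.val h).symm
    have e0b : (0 : A[(2 : ℕ)]) ≠ b' := fun h => hb0 (congrArg Subtype.val h).symm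
    have e0c : (0 : A[(2 : ℕ)]) ≠ a' + b' := fun h =>
      h1 (by rw [hab'] at h; exact (congrArg Subtype.val h).symm)
    have eab : a' ≠ b' := fun h => hab (congrArg Subtype.val h)
    have eac : a' ≠ a' + b' := fun h =>
      h2 (by rw [hab'] at h; exact (congrArg Subtype.val h).symm)
    have ebc : b' ≠ a' + b' := fun h =>
      h3 (by rw [hab'] at h; exact (congrArg Subtype.val h).symm)
    simp only [S]
    rw [Finset.card_insert_of_notMem, Finset.card_insert_of_notMem, Finset.card_insert_of_notMem,
      Finset.card_singleton]
    · simpa using ebc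
    · simp only [Finset.mem_insert, Finset.mem_singleton, not_or]; exact ⟨eab, eac⟩
    · simp only [Finset.mem_insert, Finset.mem_singleton, not_or]; exact ⟨e0a, e0b, e0c⟩
  have hcard' : Fintype.card (A[(2 : ℕ)]) = 4 := by rw [← Nat.card_eq_fintype_card, hcard]
  have hSuniv : S = Finset.univ := Finset.eq_univ_of_card S (by rw [hS, hcard'])
  have hvS : v' ∈ S := by rw [hSuniv]; exact Finset.mem_univ _
  simp only [S, Finset.mem_insert, Finset.mem_singleton] at hvS
  rcases hvS with h | h | h | h
  · left; simpa [v'] using congrArg Subtype.val h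
  · right; left; simpa [v', a'] using congrArg Subtype.val h
  · right; right; left; simpa [v', b'] using congrArg Subtype.val h
  · right; right; right; rw [hab'] at h; simpa [v'] using congrArg Subtype.val h

/-- **One witness gives all the bits** (engine-H mode A ⇒ engine G's `m = 1` pattern). For an
ALTERNATING bi-additive `B` on `A` whose `A[2]`-orthogonal inside `A[4]` is `2A` (`horth`: an
element of `A[4]` pairing trivially with `A[2]` is twice an element — the Cassels–Tate kernel
property on a finite `Ш`), with `A[2] ⊆ 2A` and `#A[2] = 4`: ONE `η₀ ∈ A[4]` of exact order `4`
that is not twice an element forces, for every non-zero `ξ ∈ A[2]`, an `η` above `ξ` and a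
`y ∈ A[2]` with `B η y ≠ 0` (the induced alternating form on `A[2] ≅ 𝔽₂²` is non-zero, hence THE
symplectic form). [cite: SilvermanAEC2009, Thm. X.4.14] [cite: SwinnertonDyer2013, §1] -/
theorem pairing_bits_of_witness (halt : ∀ x : A, B x x = 0)
    (horth : ∀ x : A, 4 • x = 0 → (∀ y : A, 2 • y = 0 → B x y = 0) → ∃ w : A, 2 • w = x)
    (hdiv : ∀ z : A, 2 • z = 0 → ∃ w : A, 2 • w = z) (hcard : Nat.card (A[(2 : ℕ)]) = 4)
    (hη : ∃ η₀ : A, 4 • η₀ = 0 ∧ 2 • η₀ ≠ 0 ∧ ¬ ∃ w : A, 2 • w = η₀) :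
    ∀ ξ : A, 2 • ξ = 0 → ξ ≠ 0 → ∃ η y : A, 2 • η = ξ ∧ 2 • y = 0 ∧ B η y ≠ 0 := by
  obtain ⟨η₀, h4η₀, h2η₀, hnd₀⟩ := hη
  have e4 : ∀ x : A, (2 * 2) • x = 4 • x := fun x => by norm_num
  -- the witness pairs non-trivially with some `y₀ ∈ A[2]`
  have hy₀ : ∃ y₀ : A, 2 • y₀ = 0 ∧ B η₀ y₀ ≠ 0 := by
    by_contra h
    exact hnd₀ (horth η₀ h4η₀ fun y hy => by by_contra hne; exact h ⟨y, hy, hne⟩)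
  obtain ⟨y₀, hy₀2, hB₀⟩ := hy₀
  intro ξ hξ hξ0
  obtain ⟨η, hη⟩ := hdiv ξ hξ
  have h4η : 4 • η = 0 := by rw [← e4, ← smul_smul, hη, hξ]
  by_contra hno
  -- `η` pairs trivially with `A[2]`, hence is twice an element
  have hηorth : ∀ y : A, 2 • y = 0 → B η y = 0 := fun y hy => by
    by_contra hne; exact hno ⟨η, y, hη, hy, hne⟩
  obtain ⟨w₁, hw₁⟩ := horth η h4η hηorth
  -- compare `ξ₀ = 2 η₀` with `ξ`
  have hξ₀2 : 2 • (2 • η₀) = 0 := by rw [smul_smul, e4, h4η₀]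
  by_cases hc : 2 • η₀ = ξ
  · -- then `η₀ - η ∈ A[2] ⊆ 2A`, so `η₀` is divisible
    have hz : 2 • (η₀ - η) = 0 := by rw [smul_sub, hc, hη, sub_self]
    obtain ⟨u, hu⟩ := hdiv _ hz
    exact hnd₀ ⟨w₁ + u, by rw [smul_add, hw₁, hu]; abel⟩
  · -- `A[2] = {0, ξ, 2η₀, ξ + 2η₀}` and `y₀` is one of them: each pairs trivially with `η₀`
    have hcases := torsionBy_two_cases hcard hξ hξ₀2 hξ0 h2η₀ (Ne.symm hc) y₀ hy₀2
    have hBξ : B η₀ ξ = 0 := by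
      -- `B η₀ (2η) = B (2η₀) η = - B η (2η₀) = 0`
      rw [← hη, map_nsmul, ← AddMonoidHom.nsmul_apply, ← map_nsmul,
        eq_neg_of_alternating B halt (2 • η₀) η, hηorth (2 • η₀) hξ₀2, neg_zero]
    have hBξ₀ : B η₀ (2 • η₀) = 0 := by
      rw [map_nsmul, halt, smul_zero]
    apply hB₀
    rcases hcases with h | h | h | h
    · rw [h, map_zero]
    · rw [h, hBξ]
    · rw [h, hBξ₀]
    · rw [h, map_add, hBξ, hBξ₀, add_zero]

/-- **Engine-H mode A, structure input discharged**: alternating `B` with the orthogonality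
property, `A[2] ⊆ 2A`, `#A[2] = 4` and ONE non-divisible element of exact order `4` ⇒
`A[8] = A[4]`. [cite: Stamminger2005, Thm. 6.2.2 (p. 73)] [cite: SilvermanAEC2009, Thm. X.4.14] -/
theorem stable_four_of_pairing_witness (halt : ∀ x : A, B x x = 0)
    (horth : ∀ x : A, 4 • x = 0 → (∀ y : A, 2 • y = 0 → B x y = 0) → ∃ w : A, 2 • w = x)
    (hdiv : ∀ z : A, 2 • z = 0 → ∃ w : A, 2 • w = z) (hcard : Nat.card (A[(2 : ℕ)]) = 4)
    (hη : ∃ η₀ : A, 4 • η₀ = 0 ∧ 2 • η₀ ≠ 0 ∧ ¬ ∃ w : A, 2 • w = η₀) :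
    ∀ x : A, 8 • x = 0 → 4 • x = 0 :=
  stable_four_of_pairing_bits B hdiv (pairing_bits_of_witness B halt horth hdiv hcard hη)

/-- **The orthogonality property from non-degeneracy** on a FINITE group: for an alternating
`B : A × A → ℚ/ℤ` with trivial kernel, an element pairing trivially with `A[2]` is twice an
element (tree `mem_range_nsmul_of_forall_torsionBy` at `p = 2`, with `(ℚ/ℤ)[2] ↪ ℤ/2`).
[cite: SilvermanAEC2009, Thm. X.4.14] -/
theorem orth_two_of_nondegenerate [Finite A] (B : A →+ A →+ AddCircle (1 : ℚ))
    (halt : ∀ x : A, B x x = 0) (hnd : ∀ x : A, (∀ y : A, B x y = 0) → x = 0) :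
    ∀ x : A, (∀ y : A, 2 • y = 0 → B x y = 0) → ∃ w : A, 2 • w = x := by
  haveI : Fact (Nat.Prime 2) := ⟨Nat.prime_two⟩
  intro x hx
  obtain ⟨ι, hι⟩ := exists_circleTorsion_toZMod_injective 2
  have hx' : ∀ y ∈ A[((2 : ℕ) : ℤ)], B x y = 0 := fun y hy =>
    hx y (AddSubgroup.torsionBy.nsmul_iff.1 hy)
  obtain ⟨w, hw⟩ := mem_range_nsmul_of_forall_torsionBy 2 B halt hnd ι hι hx'
  exact ⟨w, by simpa using hw⟩

end Algebra

/-! ### §2 `Ш(E/ℚ)`: the Cassels–Tate named fact and the X5 consumers -/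

section Sha

variable (W : WeierstrassCurve ℚ) [W.IsElliptic]

/-- **bsd.S18 on a finite `Ш(E/ℚ)` gives the orthogonality property at `2`**: from the tree's
named fact `exists_casselsTate_pairing` (Cassels 1962; Silverman X.4.14: alternating, kernel = the
divisible elements) and `Ш` finite (divisible elements `= 0`,
`divisibleElements_eq_bot_of_finite`): an alternating bi-additive `B : Ш × Ш → ℚ/ℤ` such that
every `x ∈ Ш` pairing trivially with `Ш[2]` is twice an element. CONDITIONAL on the named fact
(hypothesis `hCT`). [cite: SilvermanAEC2009, Thm. X.4.14] [cite: Cassels1962ArithmeticIV] -/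
theorem sha_orthogonal_two_of_casselsTate
    (hCT : WeierstrassCurve.exists_casselsTate_pairing (K := ℚ)) [Finite W.sha] :
    ∃ B : W.sha →+ W.sha →+ AddCircle (1 : ℚ), (∀ x, B x x = 0) ∧
      ∀ x : W.sha, (∀ y : W.sha, 2 • y = 0 → B x y = 0) → ∃ w : W.sha, 2 • w = x := by
  obtain ⟨B, halt, hker⟩ := hCT W
  have hnd : ∀ x : W.sha, (∀ y, B x y = 0) → x = 0 := by
    intro x hx
    have hmem := (hker x).1 hx
    rwa [divisibleElements_eq_bot_of_finite, AddSubgroup.mem_bot] at hmem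
  exact ⟨B, halt, orth_two_of_nondegenerate B halt hnd⟩

variable [W.IsGloballyMinimal]

/-- **X5 core, engine G shape (structure-free): `BSD(E,2)` from pairing bits.** GZK (`hGZK`),
`r_an ≤ 1`; ANY bi-additive `B` on `Ш(E/ℚ)` (engine G: the Cassels–Tate pairing on
`Sel^(4) × Sel^(2)`) exhibiting, above every non-zero `ξ ∈ Ш[2]`, an `η` and a `y ∈ Ш[2]` with
`B η y ≠ 0` (`m = 1`); `Ш[2] ⊆ 2Ш` and `#Ш[4] = 16` (engines E/F); `ord₂ #Ш_an = 4` (lane).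
[cite: SwinnertonDyer2013, §1] [cite: Miller2011LMS, Def. 1.1] -/
theorem X5.bsdp_two_of_pairing_bits (hGZK : rank_eq_analyticRank_of_analyticRank_le_one)
    (hr : W.analyticRank ≤ 1) {Q : Type*} [AddCommGroup Q] (B : W.sha →+ W.sha →+ Q)
    (hdiv : ∀ z : W.sha, 2 • z = 0 → ∃ w : W.sha, 2 • w = z)
    (hbits : ∀ ξ : W.sha, 2 • ξ = 0 → ξ ≠ 0 → ∃ η y : W.sha, 2 • η = ξ ∧ 2 • y = 0 ∧ B η y ≠ 0)
    (hcard : Nat.card (AddSubgroup.torsionBy W.sha 4) = 16)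
    {q : ℚ} (hq : shaAn W = (q : ℂ)) (hv : padicValRat 2 q = 4) : BSDp W 2 :=
  X5.bsdp_two_of_sha_eight_eq_sha_four W hGZK hr (stable_four_of_pairing_bits B hdiv hbits) hcard hq hv

/-- **X5 core, engine-H mode A shape: `BSD(E,2)` from ONE witness and bsd.S18.** GZK (`hGZK`:
`Ш` finite), the Cassels–Tate named fact (`hCT`), `r_an ≤ 1`; `#Ш[2] = 4` (engines A = B = F),
`Ш[2] ⊆ 2Ш` and `#Ш[4] = 16` (engines E/F); ONE `η₀ ∈ Ш[4]` of exact order `4` that is not twice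
an element of `Ш` (engine H mode A: one full `Ш[2]`-class of `4`-coverings with EMPTY fake
`2`-Selmer sets); `ord₂ #Ш_an = 4` (lane). No dichotomy / structure hypothesis.
[cite: Stamminger2005, Thm. 6.2.2 (p. 73)] [cite: SilvermanAEC2009, Thm. X.4.14] [cite: Miller2011LMS, Def. 1.1] -/
theorem X5.bsdp_two_of_casselsTate_witness (hGZK : rank_eq_analyticRank_of_analyticRank_le_one)
    (hCT : WeierstrassCurve.exists_casselsTate_pairing (K := ℚ)) (hr : W.analyticRank ≤ 1)
    (h2 : Nat.card (AddSubgroup.torsionBy W.sha 2) = 4)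
    (hdiv : ∀ z : W.sha, 2 • z = 0 → ∃ w : W.sha, 2 • w = z)
    (hη : ∃ η₀ : W.sha, 4 • η₀ = 0 ∧ 2 • η₀ ≠ 0 ∧ ¬ ∃ w : W.sha, 2 • w = η₀)
    (hcard : Nat.card (AddSubgroup.torsionBy W.sha 4) = 16)
    {q : ℚ} (hq : shaAn W = (q : ℂ)) (hv : padicValRat 2 q = 4) : BSDp W 2 := by
  haveI : Finite W.sha := (hGZK W hr).2
  obtain ⟨B, halt, horth⟩ := sha_orthogonal_two_of_casselsTate W hCT
  have hstab : ∀ x : W.sha, 8 • x = 0 → 4 • x = 0 :=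
    stable_four_of_pairing_witness B halt (fun x _ hx => horth x hx) hdiv (by simpa using h2) hη
  exact X5.bsdp_two_of_sha_eight_eq_sha_four W hGZK hr hstab hcard hq hv

end Sha

end Literature.NumberTheory.EllipticCurves.Rank1Residual.Typed

end
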